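import Literature.Claims.NS.ClayTorusBridge
import Mathlib.Topology.Order.Compact
import HarnessLib

/-!
# Claim skeleton (QUICK, T3 tranche): Inage (2026), «Phase Non-Persistence in Triadic Interactions:
# A Complete Resolution of the 3D Navier–Stokes Regularity Problem via Coherent Core Reduction»

Cell `ns-claims` (D-0090 NS-CLAIMS SWEEP), claim C90, T3 QUICK TRANCHE (RULINGS v1.29l (4)), typist
`ns-claims-typist-9` (g2). UNREFEREED CLAIM under adjudication — NOTHING in this file asserts a step:
the `Step…`/`Assumption…`/`Obstruction…` declarations are `Prop`s; the `theorem`s are unfolding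
identities, the kernel COMPOSITION of the paper's own chain, the Clay link, and one vacuity fact.

Version of record: Shin-Ichi Inage, Preprints.org 202603.1824 **v1** (24 Mar 2026; 52 PDF pp. = cover +
51 printed; PAGE RULE print p.N = PDF p.N+1; CC BY 4.0; not peer-reviewed). Texts:
`pub/ns-claims/sources/Inage2026/Preprints-202603.1824-v1/{pages-v1/pNNN.txt, renders-v1/pNNN.png}`
(ns-claims-lit-1; prose legible in the text layer, displays typed from the renders p019.png, p023.png,
p032.png). Bib key `Inage2026`. Locators below are PRINT pages.

## Claimed statement (as printed)

Title «A Complete Resolution of the 3D Navier–Stokes Regularity Problem»; abstract p.1 «… closes the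
energy inequality in Sobolev spaces and precludes finite-time blow-up. The argument is noncircular and
requires no external closure assumptions»; §1 p.1 frames the question as «whether a smooth divergence-free
initial datum can generate a finite-time singularity, or whether the corresponding strong solution remains
smooth for all time» (periodic setting §3.2); **Theorem 8.1** p.30 «(closure of the regularity argument)
… Hence sup_{t∈[0,T]} ‖u(t)‖_{H^s} < ∞ (242). Finite-time blow-up does not occur.»; §8.10 p.31 «Each arrow
has been proved inside the paper. No external High–High absorption assumption remains»; §9.1 p.31 «any
strong solutions u ∈ C([0,T];H^s(𝕋³)), s > 5/2, (244) cannot develop a finite-time singularity».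
Typed: `ClaimedTheorem` = global classical solvability of the UNFORCED system on `𝕋³` for every smooth
divergence-free datum (the §1 formulation; torus form of Clay (B), bridged by `ClayTorusBridge`).

## Clay delta (reference `ClayVariants.lean`)

Nearest (B). Δ1 `𝕋³` (=) · Δ3 `f ≡ 0` (= — (B) is unforced) · Δ4 smooth periodic data (=) · Δ5/Δ6 the
print speaks of strong `H^s` solutions, `s > 5/2`, and continuation on `[0,T]` («the standard continuation
criterion for strong solutions» p.30 [6,7,11,12]) — typed in the tree's classical-solution vocabulary on
`𝕋³ × [0,∞)`; no typed delta: `clay_of_claimed : ClaimedTheorem → clayPeriodic.Regularity` PROVED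
(`clayPeriodic_regularityAt_iff_torus`).

## Steps — the printed chain (243) p.31 «PDE ⟹ Fourier triads ⟹ HH core localization ⟹ coherent time
## sets ⟹ phase non-persistence ⟹ budget compression ⟹ shellwise absorption ⟹ global regularity»
## at QUICK grain: the REDUCTION (Chapters 4–5) and the BRIDGE (Chapter 7's standing assumption)

The paper attaches to a strong solution `u`, a shell index `j`, a «dangerous triadic family» `ℱ_j(τ)` and
a low-drift threshold `λ` the shell observables of Chapters 5–6: the curvature kernel `K_{τ,j}(t)`
((111)–(112) p.17), the shell quantity `Θ_j` ((115) p.17), and the coherent low-drift dangerous time set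
`D_{τ,j}(λ) ⊆ [0,T]` ((107) p.16 / (150) p.22). These constructions (Fourier–helical, displays garbled in
the text layer) are NOT typed at QUICK grain: they enter as an abstract ATTACHMENT `att` (a parameter of
the steps, `ShellObservables`-valued), exactly as the paper's logic consumes them — only through the
single scalar inequality (123)/(157).

* `Obstruction123 O` — (123) p.18, §5.8 «Reduction to Single Obstruction»: «Thus, the Navier–Stokes
  regularity problem reduces to proving: ∫_{D_{τ,j}(λ)} |K_{τ,j}(t)| dt ≳ 2^j Θ_j |D_{τ,j}(λ)|. (123)
  This is the single obstruction.» §5.10 p.18: «The global regularity problem has been reduced to a single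
  scalar inequality (123). All remaining analysis is devoted to proving this inequality.»
* `Assumption75 O` — (157) p.22, §7.2 «Standing Assumptions for the Present Chapter … The following
  assumptions are in force throughout this chapter. … Assumption 7.5 (global average transversality)
  There exists κ > 0, independent of j, such that ∫_{D_{τ,j}(λ)} |K_{τ,j}(t)| dt ≥ κ 2^j Θ_j |D_{τ,j}(λ)|.
  (157)» — THE SAME INEQUALITY (`assumption75_iff_obstruction123`, `Iff.rfl`). Theorem 7.2 (phase
  non-persistence) p.26 is stated «Under Assumptions 7.1–7.5»; its proof opens «From Proposition 7.1,
  ∫_{D_{τ,j}(λ)}|K_{τ,j}| dt ≥ c 2^jΘ_j |D_{τ,j}(λ)| (198)», and §7.3 p.22 extracts the good blocks feeding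
  Lemma C → Lemma A′ → Proposition 7.1 «from the global average lower bound (157)»; p.27: «Theorem 7.2
  proves that obstruction. Therefore, the reduction of Chapter 5 is now closed».
* Step 1 = `Step1_Reduction att` — §5.8 p.18 (bold): «If the curvature kernel K_{τ,j} has a uniform
  lower bound on coherent intervals, then the total coherent time is small, and no blow-up can occur.»
  = [(123) for every strong solution] ⇒ `ClaimedTheorem` (Chapters 4–5 + 8; asserted implication).
* **Step 2 = `Step2_Bridge75 att` — LOAD-BEARING**: Assumption 7.5 (157) holds for EVERY strong solution
  (κ independent of j) — what Theorem 7.2/8.1 need to be unconditional; offered justification p.22: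
  «These assumptions are not auxiliary hypotheses external to the proof. … (157) is the shellwise averaged
  transversality prepared by the curvature-budget reduction» (= Chapter 5, which REDUCED the problem TO
  (157) = (123)). SUSPICIOUS (typist): the obstruction is assumed in the chapter that proves it.
* `Theorem81_literal` — Theorem 8.1 as printed p.30: hypothesis (237) `u ∈ C([0,T];H^s(𝕋³))` on the CLOSED
  interval, conclusion (242) `sup_{t∈[0,T]} ‖u(t)‖_{H^s} < ∞` — automatic for a continuous function on a
  compact interval: `theorem81_literal_holds` (PROVED; F15: the statement's own grain; the non-trivial
  content — a bound for the maximal solution on `[0,T*)` — is Step 1's consequent).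

## COMPOSITION — proved as `claim_of_steps`

`claim_of_steps att : Step1_Reduction att → Step2_Bridge75 att → ClaimedTheorem` (modus ponens through
`assumption75_iff_obstruction123`). The paper's logic COMPOSES; the adjudication is about Step 2.

## Design / conventions

`𝕋³ = UnitAddTorus (Fin 3)`; solutions in the tree's torus vocabulary `Torus.IsClassicalNSSolutionOn
(Icc 0 T) μ 0 U P` (`FunctionSpaces/TorusFluidGlue.lean`); `|D|` = `(volume D).toReal`, the integrals
are Bochner set integrals `∫ t in D, |K t|`; no instance, no notation, no axiom, no sorry; (B) cited
through `ClayVariants`/`ClayTorusBridge`, not restated.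

WHAT THIS IS NOT: not a claim about NS regularity or blow-up; not a claim about any author beyond the
typed locator.
-/

noncomputable section

open Set MeasureTheory

namespace Literature.Claims.NS.Inage2026

open Literature.Analysis.FunctionSpaces

/-! ## §A. Vocabulary -/

/-- Physical space values `ℝ³`. [cite: Inage2026, §3.2 p.9] -/
abbrev E3 : Type := EuclideanSpace ℝ (Fin 3)

/-- The periodic box `𝕋³`. [cite: Inage2026, §3.2 p.9] -/
abbrev T3 : Type := UnitAddTorus (Fin 3)

/-- The shell observables the argument consumes, for a fixed dangerous triadic family `τ` and low-drift
threshold `λ`: per shell `j`, the curvature kernel `t ↦ K_{τ,j}(t)` ((111)–(112) p.17), the shell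
quantity `Θ_j` ((115) p.17) and the coherent low-drift dangerous time set `D_{τ,j}(λ)` ((107) p.16,
(150) p.22). Plain data; the paper's Fourier–helical construction of them from a solution (Chapters 3–6)
is the ATTACHMENT parameter `att` of the steps and is not typed (QUICK grain).
[cite: Inage2026, (111)–(115) p.17; (150) p.22] -/
structure ShellObservables where
  /-- `K_{τ,j}(t)`. -/
  K : ℕ → ℝ → ℝ
  /-- `Θ_j`. -/
  Θ : ℕ → ℝ
  /-- `D_{τ,j}(λ)`. -/
  D : ℕ → Set ℝ

/-- An ATTACHMENT: shell observables assigned to a velocity field on `𝕋³ × [0,T]` (the paper's Chapters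
3–6). [cite: Inage2026, Chapters 3–6 pp.8–21] -/
abbrev Attachment : Type := (ℝ → T3 → E3) → ℝ → ShellObservables

/-- «Strong solution on `[0,T]`» ((149) p.21 = (237) p.30: `u ∈ C([0,T];H^s(𝕋³)) ∩ L²(0,T;H^{s+1})`,
`s > 5/2`), rendered on the tree's classical subclass: an unforced classical solution `(U, P)` with
viscosity `μ` on `𝕋³ × [0,T]`. [cite: Inage2026, (149) p.21; (237) p.30] -/
def IsStrongSolutionOn (μ T : ℝ) (U : ℝ → T3 → E3) (P : ℝ → T3 → ℝ) : Prop :=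
  Torus.IsClassicalNSSolutionOn (Icc 0 T) μ 0 U P

/-- **(123)** p.18 — THE SINGLE OBSTRUCTION: «∫_{D_{τ,j}(λ)} |K_{τ,j}(t)| dt ≳ 2^j Θ_j |D_{τ,j}(λ)|» with a
`j`-independent constant (§5.8: «If the curvature kernel has a uniform lower bound on coherent
intervals …»). [cite: Inage2026, (123) p.18] -/
def Obstruction123 (O : ShellObservables) : Prop :=
  ∃ κ : ℝ, 0 < κ ∧ ∀ j : ℕ,
    κ * 2 ^ j * O.Θ j * (volume (O.D j)).toReal ≤ ∫ t in O.D j, |O.K j t|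

/-- **Assumption 7.5 (157)** p.22 (global average transversality), «in force throughout this chapter»:
«There exists κ > 0, independent of j, such that ∫_{D_{τ,j}(λ)} |K_{τ,j}(t)| dt ≥ κ 2^j Θ_j |D_{τ,j}(λ)|.»
[cite: Inage2026, Assumption 7.5 (157) p.22] -/
def Assumption75 (O : ShellObservables) : Prop :=
  ∃ κ : ℝ, 0 < κ ∧ ∀ j : ℕ,
    κ * 2 ^ j * O.Θ j * (volume (O.D j)).toReal ≤ ∫ t in O.D j, |O.K j t|

/-- **The standing assumption of Chapter 7 IS the single obstruction of Chapter 5** — (157) p.22 and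
(123) p.18 are the same inequality (definitionally). Chapter 7 («All remaining analysis is devoted to
proving this inequality», p.18; «Theorem 7.2 proves that obstruction», p.27) proves Theorem 7.2 «Under
Assumptions 7.1–7.5» (p.26). [cite: Inage2026, (123) p.18; (157) p.22; Theorem 7.2 p.26] -/
theorem assumption75_iff_obstruction123 (O : ShellObservables) : Assumption75 O ↔ Obstruction123 O :=
  Iff.rfl

/-! ## §B. The claimed statement and the Clay link -/

/-- **CLAIMED THEOREM** (§1 p.1 «whether a smooth divergence-free initial datum can generate a finite-time
singularity, or whether the corresponding strong solution remains smooth for all time»; Theorem 8.1 p.30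
«Finite-time blow-up does not occur»; §9.1 p.31 (244)): for every viscosity `μ > 0` and every smooth
divergence-free datum on `𝕋³` the unforced system has a classical solution on `𝕋³ × [0,∞)`.
[cite: Inage2026, Theorem 8.1 p.30; §9.1 (244) p.31; §1 p.1] -/
def ClaimedTheorem : Prop :=
  ∀ μ : ℝ, 0 < μ → ∀ U₀ : T3 → E3, Torus.IsSmooth U₀ → Torus.IsDivFree U₀ →
    ∃ (U : ℝ → T3 → E3) (P : ℝ → T3 → ℝ), Torus.IsClassicalNSSolutionOn (Ici 0) μ 0 U P ∧ U 0 = U₀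

/-- The claim implies Clay (B) (torus bridge `clayPeriodic_regularityAt_iff_torus`; no delta).
[cite: Inage2026, Theorem 8.1 p.30] -/
theorem clay_of_claimed (h : ClaimedTheorem) : ClayVariants.clayPeriodic.Regularity :=
  fun μ hμ => (ClayVariants.clayPeriodic_regularityAt_iff_torus hμ).2 (h μ hμ)

/-- … and conversely: the claim IS (B) in torus form. [cite: Inage2026, Theorem 8.1 p.30] -/
theorem claimedTheorem_iff : ClaimedTheorem ↔ ClayVariants.clayPeriodic.Regularity :=
  ⟨clay_of_claimed, fun h μ hμ => (ClayVariants.clayPeriodic_regularityAt_iff_torus hμ).1 (h μ hμ)⟩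

/-! ## §C. The steps -/

/-- **Step 1 — the reduction** (§5.8 p.18, bold): «If the curvature kernel K_{τ,j} has a uniform lower
bound on coherent intervals, then the total coherent time is small, and no blow-up can occur. Thus, the
Navier–Stokes regularity problem reduces to proving (123).» (Chapters 4–5 with the closure of Chapter 8,
(226)–(242) p.29–30.) Typed, for the attachment `att`: if (123) holds for the observables of every strong
solution on every `[0,T]`, then `ClaimedTheorem`. [cite: Inage2026, §5.8 (123) p.18; Theorem 8.1 p.30] -/
def Step1_Reduction (att : Attachment) : Prop :=
  (∀ (μ T : ℝ) (U : ℝ → T3 → E3) (P : ℝ → T3 → ℝ), 0 < μ → 0 < T → IsStrongSolutionOn μ T U P →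
      Obstruction123 (att U T)) → ClaimedTheorem

/-- **Step 2 — LOAD-BEARING: the bridge** — Assumption 7.5 (157) p.22 holds for EVERY strong solution on
every `[0,T]` with `κ` independent of `j` (what makes Theorem 7.2 p.26, stated «Under Assumptions
7.1–7.5», and hence Theorem 8.1 p.30 unconditional). Offered justification p.22: «These assumptions are not
auxiliary hypotheses external to the proof. Each of them has already been prepared in Chapters 5–6: …
(157) is the shellwise averaged transversality prepared by the curvature-budget reduction.»
[cite: Inage2026, Assumption 7.5 (157) p.22; Theorem 7.2 p.26; §8.10 p.31] -/
def Step2_Bridge75 (att : Attachment) : Prop :=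
  ∀ (μ T : ℝ) (U : ℝ → T3 → E3) (P : ℝ → T3 → ℝ), 0 < μ → 0 < T → IsStrongSolutionOn μ T U P →
    Assumption75 (att U T)

/-- **Theorem 8.1 as printed** (p.30), at the statement's own grain (F15): for `u ∈ C([0,T]; X)` on the
CLOSED interval ((237)), `sup_{t∈[0,T]} ‖u(t)‖ < ∞` ((242)). Typed over an arbitrary normed space `X`
(for `H^s(𝕋³)`). [cite: Inage2026, Theorem 8.1 (237) (242) p.30] -/
def Theorem81_literal : Prop :=
  ∀ (X : Type) [NormedAddCommGroup X] (T : ℝ) (u : ℝ → X), ContinuousOn u (Icc 0 T) →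
    ∃ C : ℝ, ∀ t ∈ Icc 0 T, ‖u t‖ ≤ C

/-- (242) follows from (237) alone: a continuous function on the compact interval `[0,T]` is bounded.
[cite: Inage2026, Theorem 8.1 (237) (242) p.30] -/
theorem theorem81_literal_holds : Theorem81_literal := by
  intro X _ T u hu
  obtain ⟨C, hC⟩ := (isCompact_Icc (a := (0 : ℝ)) (b := T)).exists_bound_of_continuousOn hu
  exact ⟨C, hC⟩

/-! ## §D. Composition (kernel) -/

/-- **COMPOSITION** — the printed chain (243) p.31 at QUICK grain: reduction (Step 1) + bridge (Step 2)
⇒ the claim, through `assumption75_iff_obstruction123`. PROVED (modus ponens).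
[cite: Inage2026, (243) p.31; §8.12 p.31 «Chapters 1–8 together form a complete proof»] -/
theorem claim_of_steps (att : Attachment) (h1 : Step1_Reduction att) (h2 : Step2_Bridge75 att) :
    ClaimedTheorem :=
  h1 fun μ T U P hμ hT hsol => (assumption75_iff_obstruction123 (att U T)).1 (h2 μ T U P hμ hT hsol)

/-- Under the two steps, Clay (B). [cite: Inage2026, Theorem 8.1 p.30] -/
theorem clay_of_steps (att : Attachment) (h1 : Step1_Reduction att) (h2 : Step2_Bridge75 att) :
    ClayVariants.clayPeriodic.Regularity :=
  clay_of_claimed (claim_of_steps att h1 h2)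

end Literature.Claims.NS.Inage2026

end
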